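import Summits.CriticalPhenomena.PercolationContinuityZ3.Theorems.SahiIsingCrossBox
import Literature.Probability.LatticeModels.PlusMinusStateGibbs
import Literature.Probability.Percolation.SiteSubgraphMonotonicity

/-!
# The DLR sandwich `μ⁻ ≤_st μ ≤_st μ⁺` for EVERY infinite-volume Ising Gibbs measure and ALL measurable increasing
# functionals (tail events included) — density-free, via the cross box condition

Support file of the Sahi cell (`prim-sahi`, typer seat, generation 16; `--supports stmt-CriticalPhenomena-4575`).
Theorems only (no definitions, no named facts, no sorries).  Sequel of generation 15's `SahiIsingCrossBox.lean`
(`μ⁻ ≤_st μ⁺` for all bounded measurable increasing functionals, from the cross box condition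
`μ₁[a,b] μ₂[a',b'] ≤ μ₁[a ∧ a', b ∧ b'] μ₂[a ∨ a', b ∨ b']` and the density-free Holley inequality
`SahiIsingHolleyNonlocal.holley_of_crossBox_spin`).

IN PRINT.  For the nearest-neighbour Ising model on `ℤ^d` (`β ≥ 0`, any `h`) every DLR Gibbs measure `μ ∈ 𝒢(β,h)`
satisfies `μ⁻_{β,h}(f) ≤ μ(f) ≤ μ⁺_{β,h}(f)` for every nondecreasing LOCAL `f` [Friedli–Velenik 2017, proof of
Lemma 6.65, eq. (6.70), p. 311; Lemma 3.23] — the tree's `Literature.Probability.LatticeModels.fkg_sandwich_holds`;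
Georgii–Higuchi 2000 (§2, p. 3) use "the sandwich relation `μ⁻ ≼ μ ≼ μ⁺` for any other `μ ∈ 𝒢`" in the sense of
stochastic domination.  The extension from local observables to ALL bounded measurable increasing functionals of the
infinite configuration (e.g. indicators of increasing tail events, `{x ↔ ∞ through + spins}`) is classically obtained
through monotone couplings (Strassen / Holley); here it is obtained WITHOUT couplings and without any density or
positivity, from the cross box condition:

* `crossBox_of_lintegral_left` / `crossBox_of_lintegral_right` — **the cross box condition is closed under mixtures
  in either argument**: if `μ(A) = ∫ γ_η(A) dρ(η)` on measurable sets and every `γ_η` satisfies the cross box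
  condition with `ν` (on the appropriate side), so does `μ` (linearity; no measurability of `η ↦ γ_η` is needed).
* `crossBox_gibbs_isingMeasure_plus` / `crossBox_isingMeasure_minus_gibbs` — for ANY countable locally finite graph,
  `β ≥ 0`, any `h`, any finite `Λ` and any DLR Gibbs measure `μ` of the Ising specification: `μ` and the
  finite-volume PLUS measure `μ⁺_{Λ;β,h}` satisfy the cross box condition (and `μ⁻_{Λ;β,h}`, `μ` do): the DLR
  equation `μ = ∫ μ^η_Λ dμ(η)` mixes generation 15's Holley condition for the boundary conditions `η ≤ +`
  (`crossBox_isingMeasure_fixed`).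
* `crossBox_gibbs_of_tendsto_plus` / `crossBox_of_tendsto_minus_gibbs` — hence `μ` and any LOCAL LIMIT of plus
  measures `μ⁺_{Λ_L;β,h}` (any volumes) satisfy the cross box condition (`crossBox_of_tendsto_local₂` with a constant
  first sequence); dually for minus measures.
* ON `ℤ^d` (`crossBox_gibbs_plusState`, `crossBox_minusState_gibbs`): for every `μ ∈ 𝒢(β,h)` and every probability
  measures `μ⁻`, `μ⁺` with the minus / plus correlations,
  **`gibbs_le_plusState_upperSet` / `minusState_le_gibbs_upperSet`: `μ⁻(U) ≤ μ(U) ≤ μ⁺(U)` for EVERY measurable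
  increasing event `U` of the infinite configuration**, and **`gibbs_le_plusState` / `minusState_le_gibbs`:
  `∫ f dμ⁻ ≤ ∫ f dμ ≤ ∫ f dμ⁺` for EVERY bounded measurable increasing functional** (`gibbs_sandwich_upperSet`,
  `gibbs_sandwich`); consequences: an increasing event on which `μ⁻` and `μ⁺` agree has the same probability under
  every Gibbs measure (`gibbs_upperSet_eq_of_minusState_eq_plusState`), and the plus state is the MAXIMUM of
  `𝒢(β,h)` in the strong stochastic order (`exists_gibbs_maximum`, `exists_gibbs_minimum`, packaged with the tree's
  `exists_plusMeasure_holds` / `exists_minusMeasure_holds`).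
* PERCOLATION OF `+` SPINS (Georgii–Higuchi's events `{x ↔ ∞ in S⁺(ω)}`, `E⁺`, which are increasing and NON-LOCAL):
  `gibbs_sandwich_plusPercolatesAt`, `gibbs_sandwich_existsInfCluster` — `μ⁻ ≤ μ ≤ μ⁺` on them for every Gibbs
  measure; `gibbs_existsInfCluster_eq_zero_of_plusState` / `_eq_one_of_minusState`.

No sorries, no new axioms.
-/

noncomputable section

namespace Summit.CriticalPhenomena.PercolationContinuityZ3.Theorems.SahiBoxTP2

open MeasureTheory Set Filter Topology Function
open Literature.Probability.LatticeModels
open scoped ENNReal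

/-! ### The cross box condition is closed under mixtures -/

section Mixture

variable {X E : Type*} [MeasurableSpace X] [Lattice X] [MeasurableSpace E]

/-- **Mixing the first argument**: if `μ(A) = ∫ γ_η(A) dρ(η)` for measurable `A`, the boxes are measurable, and each
`γ_η` satisfies the cross box condition with `ν` on the right, then so does `μ`. [this work] -/
theorem crossBox_of_lintegral_left (hIcc : ∀ p q : X, MeasurableSet (Icc p q)) (γ : E → Measure X)
    (ρ : Measure E) (μ ν : Measure X) [IsFiniteMeasure ν]
    (hmix : ∀ A : Set X, MeasurableSet A → ∫⁻ η, γ η A ∂ρ = μ A)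
    (hcross : ∀ η (a b a' b' : X),
      γ η (Icc a b) * ν (Icc a' b') ≤ γ η (Icc (a ⊓ a') (b ⊓ b')) * ν (Icc (a ⊔ a') (b ⊔ b')))
    (a b a' b' : X) :
    μ (Icc a b) * ν (Icc a' b') ≤ μ (Icc (a ⊓ a') (b ⊓ b')) * ν (Icc (a ⊔ a') (b ⊔ b')) := by
  rw [← hmix _ (hIcc a b), ← hmix _ (hIcc _ _), ← lintegral_mul_const' _ _ (measure_ne_top ν _),
    ← lintegral_mul_const' _ _ (measure_ne_top ν _)]
  exact lintegral_mono fun η => hcross η a b a' b'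

/-- **Mixing the second argument**: if `ν(A) = ∫ γ_η(A) dρ(η)` for measurable `A` and each `γ_η` satisfies the
cross box condition with `μ` on the left, then so does `ν`. [this work] -/
theorem crossBox_of_lintegral_right (hIcc : ∀ p q : X, MeasurableSet (Icc p q)) (γ : E → Measure X)
    (ρ : Measure E) (μ ν : Measure X) [IsFiniteMeasure μ]
    (hmix : ∀ A : Set X, MeasurableSet A → ∫⁻ η, γ η A ∂ρ = ν A)
    (hcross : ∀ η (a b a' b' : X),
      μ (Icc a b) * γ η (Icc a' b') ≤ μ (Icc (a ⊓ a') (b ⊓ b')) * γ η (Icc (a ⊔ a') (b ⊔ b')))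
    (a b a' b' : X) :
    μ (Icc a b) * ν (Icc a' b') ≤ μ (Icc (a ⊓ a') (b ⊓ b')) * ν (Icc (a ⊔ a') (b ⊔ b')) := by
  rw [← hmix _ (hIcc a' b'), ← hmix _ (hIcc _ _), ← lintegral_const_mul' _ _ (measure_ne_top μ _),
    ← lintegral_const_mul' _ _ (measure_ne_top μ _)]
  exact lintegral_mono fun η => hcross η a b a' b'

end Mixture

/-! ### A DLR Gibbs measure against the finite-volume `±` measures: any countable locally finite graph -/

section Graph

variable {V : Type*} (G : SimpleGraph V) [DecidableEq V] [G.LocallyFinite] [Countable V]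

/-- **A DLR Gibbs measure and the finite-volume plus measure satisfy the cross box condition** (`β ≥ 0`, any `h`,
any finite `Λ`): `μ[a,b] μ⁺_Λ[a',b'] ≤ μ[a ∧ a', b ∧ b'] μ⁺_Λ[a ∨ a', b ∨ b']` — the DLR equation
`μ = ∫ μ^η_Λ dμ(η)` mixes the Holley condition for the boundary conditions `η ≤ +`. [this work] -/
theorem crossBox_gibbs_isingMeasure_plus {β : ℝ} (hβ : 0 ≤ β) (h : ℝ) {μ : Measure (SpinConfig V)}
    (hμ : IsGibbsMeasure (isingSpecification G β h) μ) (Λ : Finset V) (a b a' b' : SpinConfig V) :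
    μ (Icc a b) * isingMeasure G Λ β h .plus (Icc a' b') ≤
      μ (Icc (a ⊓ a') (b ⊓ b')) * isingMeasure G Λ β h .plus (Icc (a ⊔ a') (b ⊔ b')) :=
  crossBox_of_lintegral_left measurableSet_Icc_spinConfig (fun η => isingMeasure G Λ β h (.fixed η)) μ μ _
    (fun A hA => hμ.2 Λ A hA)
    (fun η p q p' q' => crossBox_isingMeasure_fixed G Λ hβ h (η := η) (η' := 1) (fun _ => intUnits_le_one _)
      p q p' q') a b a' b'

/-- **The finite-volume minus measure and a DLR Gibbs measure satisfy the cross box condition** (`β ≥ 0`, any `h`,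
any finite `Λ`): `μ⁻_Λ[a,b] μ[a',b'] ≤ μ⁻_Λ[a ∧ a', b ∧ b'] μ[a ∨ a', b ∨ b']`. [this work] -/
theorem crossBox_isingMeasure_minus_gibbs {β : ℝ} (hβ : 0 ≤ β) (h : ℝ) {μ : Measure (SpinConfig V)}
    (hμ : IsGibbsMeasure (isingSpecification G β h) μ) (Λ : Finset V) (a b a' b' : SpinConfig V) :
    isingMeasure G Λ β h .minus (Icc a b) * μ (Icc a' b') ≤
      isingMeasure G Λ β h .minus (Icc (a ⊓ a') (b ⊓ b')) * μ (Icc (a ⊔ a') (b ⊔ b')) :=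
  crossBox_of_lintegral_right measurableSet_Icc_spinConfig (fun η => isingMeasure G Λ β h (.fixed η)) μ _ μ
    (fun A hA => hμ.2 Λ A hA)
    (fun η p q p' q' => crossBox_isingMeasure_fixed G Λ hβ h (η := -1) (η' := η) (fun _ => neg_one_le_intUnits _)
      p q p' q') a b a' b'

/-- **A DLR Gibbs measure and any local limit of finite-volume plus measures satisfy the cross box condition**
(any volumes `Λ_L`, `β ≥ 0`, any `h`). [this work] -/
theorem crossBox_gibbs_of_tendsto_plus {β : ℝ} (hβ : 0 ≤ β) (h : ℝ) {μ : Measure (SpinConfig V)}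
    (hμ : IsGibbsMeasure (isingSpecification G β h) μ) (Λs : ℕ → Finset V) (μ' : Measure (SpinConfig V))
    [IsFiniteMeasure μ']
    (hconv' : ∀ (J : Finset V) (C : Set (V → ℤˣ)), MeasurableSet C → DependsOn (fun σ => σ ∈ C) (↑J : Set V) →
      Tendsto (fun L => isingMeasure G (Λs L) β h .plus C) atTop (𝓝 (μ' C)))
    (a b a' b' : SpinConfig V) :
    μ (Icc a b) * μ' (Icc a' b') ≤ μ (Icc (a ⊓ a') (b ⊓ b')) * μ' (Icc (a ⊔ a') (b ⊔ b')) := by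
  haveI := hμ.isProbabilityMeasure
  exact crossBox_of_tendsto_local₂ (fun _ => μ) (fun L => isingMeasure G (Λs L) β h .plus) μ μ'
    (fun L p q p' q' => crossBox_gibbs_isingMeasure_plus G hβ h hμ (Λs L) p q p' q')
    (fun _ _ _ _ => tendsto_const_nhds) hconv' a b a' b'

/-- **Any local limit of finite-volume minus measures and a DLR Gibbs measure satisfy the cross box condition**
(any volumes `Λ_L`, `β ≥ 0`, any `h`). [this work] -/
theorem crossBox_of_tendsto_minus_gibbs {β : ℝ} (hβ : 0 ≤ β) (h : ℝ) {μ : Measure (SpinConfig V)}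
    (hμ : IsGibbsMeasure (isingSpecification G β h) μ) (Λs : ℕ → Finset V) (μ' : Measure (SpinConfig V))
    [IsFiniteMeasure μ']
    (hconv' : ∀ (J : Finset V) (C : Set (V → ℤˣ)), MeasurableSet C → DependsOn (fun σ => σ ∈ C) (↑J : Set V) →
      Tendsto (fun L => isingMeasure G (Λs L) β h .minus C) atTop (𝓝 (μ' C)))
    (a b a' b' : SpinConfig V) :
    μ' (Icc a b) * μ (Icc a' b') ≤ μ' (Icc (a ⊓ a') (b ⊓ b')) * μ (Icc (a ⊔ a') (b ⊔ b')) := by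
  haveI := hμ.isProbabilityMeasure
  exact crossBox_of_tendsto_local₂ (fun L => isingMeasure G (Λs L) β h .minus) (fun _ => μ) μ' μ
    (fun L p q p' q' => crossBox_isingMeasure_minus_gibbs G hβ h hμ (Λs L) p q p' q')
    hconv' (fun _ _ _ _ => tendsto_const_nhds) a b a' b'

/-- **Hence a DLR Gibbs measure lies stochastically below any local limit of plus measures, for ALL bounded
measurable increasing functionals** (`μ'` a probability measure). [this work] -/
theorem gibbs_integral_le_of_tendsto_plus {β : ℝ} (hβ : 0 ≤ β) (h : ℝ) {μ : Measure (SpinConfig V)}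
    (hμ : IsGibbsMeasure (isingSpecification G β h) μ) (Λs : ℕ → Finset V) (μ' : Measure (SpinConfig V))
    [IsProbabilityMeasure μ']
    (hconv' : ∀ (J : Finset V) (C : Set (V → ℤˣ)), MeasurableSet C → DependsOn (fun σ => σ ∈ C) (↑J : Set V) →
      Tendsto (fun L => isingMeasure G (Λs L) β h .plus C) atTop (𝓝 (μ' C)))
    {f : SpinConfig V → ℝ} (hf : Monotone f) (hfm : Measurable f) {C : ℝ} (hfC : ∀ x, |f x| ≤ C) :
    ∫ x, f x ∂μ ≤ ∫ x, f x ∂μ' := by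
  haveI := hμ.isProbabilityMeasure
  exact holley_of_crossBox_spin μ μ' (crossBox_gibbs_of_tendsto_plus G hβ h hμ Λs μ' hconv') hf hfm hfC

/-- **… and above any local limit of minus measures.** [this work] -/
theorem integral_le_gibbs_of_tendsto_minus {β : ℝ} (hβ : 0 ≤ β) (h : ℝ) {μ : Measure (SpinConfig V)}
    (hμ : IsGibbsMeasure (isingSpecification G β h) μ) (Λs : ℕ → Finset V) (μ' : Measure (SpinConfig V))
    [IsProbabilityMeasure μ']
    (hconv' : ∀ (J : Finset V) (C : Set (V → ℤˣ)), MeasurableSet C → DependsOn (fun σ => σ ∈ C) (↑J : Set V) →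
      Tendsto (fun L => isingMeasure G (Λs L) β h .minus C) atTop (𝓝 (μ' C)))
    {f : SpinConfig V → ℝ} (hf : Monotone f) (hfm : Measurable f) {C : ℝ} (hfC : ∀ x, |f x| ≤ C) :
    ∫ x, f x ∂μ' ≤ ∫ x, f x ∂μ := by
  haveI := hμ.isProbabilityMeasure
  exact holley_of_crossBox_spin μ' μ (crossBox_of_tendsto_minus_gibbs G hβ h hμ Λs μ' hconv') hf hfm hfC

end Graph

/-! ### `ℤ^d`: every Gibbs measure lies between `μ⁻` and `μ⁺` in the strong stochastic order -/

section States

variable {d : ℕ} {β h : ℝ}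

/-- **A Gibbs measure of `ℤ^d` and the plus state satisfy the cross box condition** (`β ≥ 0`, any `h`; `μ⁺` = any
probability measure with the plus correlations). [this work] -/
theorem crossBox_gibbs_plusState (hβ : 0 ≤ β) {μ : Measure (SpinConfig (Site d))} (hμ : μ ∈ isingGibbsMeasures d β h)
    (μp : Measure (SpinConfig (Site d))) [IsProbabilityMeasure μp]
    (hμp : ∀ B : Finset (Site d), spinCorr μp B = plusCorr d β h B) (a b a' b' : SpinConfig (Site d)) :
    μ (Icc a b) * μp (Icc a' b') ≤ μ (Icc (a ⊓ a') (b ⊓ b')) * μp (Icc (a ⊔ a') (b ⊔ b')) := by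
  classical
  rw [mem_isingGibbsMeasures_iff] at hμ
  exact crossBox_gibbs_of_tendsto_plus (zdGraph d) hβ h hμ (fun L => box d L) μp
    (fun J C hCm hC => tendsto_isingMeasure_box_of_forall_spinCorr .plus (tendsto_isingCorr_plus_box hβ h) μp hμp
      J hCm hC) a b a' b'

/-- **The minus state and a Gibbs measure of `ℤ^d` satisfy the cross box condition** (`β ≥ 0`, any `h`).
[this work] -/
theorem crossBox_minusState_gibbs (hβ : 0 ≤ β) {μ : Measure (SpinConfig (Site d))} (hμ : μ ∈ isingGibbsMeasures d β h)
    (μm : Measure (SpinConfig (Site d))) [IsProbabilityMeasure μm]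
    (hμm : ∀ B : Finset (Site d), spinCorr μm B = minusCorr d β h B) (a b a' b' : SpinConfig (Site d)) :
    μm (Icc a b) * μ (Icc a' b') ≤ μm (Icc (a ⊓ a') (b ⊓ b')) * μ (Icc (a ⊔ a') (b ⊔ b')) := by
  classical
  rw [mem_isingGibbsMeasures_iff] at hμ
  exact crossBox_of_tendsto_minus_gibbs (zdGraph d) hβ h hμ (fun L => box d L) μm
    (fun J C hCm hC => tendsto_isingMeasure_box_of_forall_spinCorr .minus (tendsto_isingCorr_minus_box hβ h) μm hμm
      J hCm hC) a b a' b'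

/-- **`μ(U) ≤ μ⁺(U)` for EVERY Gibbs measure and EVERY measurable increasing event** of the infinite configuration
(tail events included; `β ≥ 0`, any `h`). [this work] -/
theorem gibbs_le_plusState_upperSet (hβ : 0 ≤ β) {μ : Measure (SpinConfig (Site d))}
    (hμ : μ ∈ isingGibbsMeasures d β h) (μp : Measure (SpinConfig (Site d))) [IsProbabilityMeasure μp]
    (hμp : ∀ B : Finset (Site d), spinCorr μp B = plusCorr d β h B) {U : Set (SpinConfig (Site d))}
    (hU : IsUpperSet U) (hUm : MeasurableSet U) : μ U ≤ μp U := by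
  haveI := ((mem_isingGibbsMeasures_iff d β h μ).1 hμ).isProbabilityMeasure
  simpa only [measure_univ, mul_one, one_mul] using
    holley_upperSet_of_crossBox_spin μ μp (crossBox_gibbs_plusState hβ hμ μp hμp) hU hUm

/-- **`μ⁻(U) ≤ μ(U)` for EVERY Gibbs measure and EVERY measurable increasing event.** [this work] -/
theorem minusState_le_gibbs_upperSet (hβ : 0 ≤ β) {μ : Measure (SpinConfig (Site d))}
    (hμ : μ ∈ isingGibbsMeasures d β h) (μm : Measure (SpinConfig (Site d))) [IsProbabilityMeasure μm]
    (hμm : ∀ B : Finset (Site d), spinCorr μm B = minusCorr d β h B) {U : Set (SpinConfig (Site d))}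
    (hU : IsUpperSet U) (hUm : MeasurableSet U) : μm U ≤ μ U := by
  haveI := ((mem_isingGibbsMeasures_iff d β h μ).1 hμ).isProbabilityMeasure
  simpa only [measure_univ, mul_one, one_mul] using
    holley_upperSet_of_crossBox_spin μm μ (crossBox_minusState_gibbs hβ hμ μm hμm) hU hUm

/-- **`∫ f dμ ≤ ∫ f dμ⁺` for EVERY Gibbs measure and EVERY bounded measurable increasing functional** of the
infinite configuration (`β ≥ 0`, any `h`). [this work] -/
theorem gibbs_le_plusState (hβ : 0 ≤ β) {μ : Measure (SpinConfig (Site d))} (hμ : μ ∈ isingGibbsMeasures d β h)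
    (μp : Measure (SpinConfig (Site d))) [IsProbabilityMeasure μp]
    (hμp : ∀ B : Finset (Site d), spinCorr μp B = plusCorr d β h B) {f : SpinConfig (Site d) → ℝ}
    (hf : Monotone f) (hfm : Measurable f) {C : ℝ} (hfC : ∀ x, |f x| ≤ C) : ∫ x, f x ∂μ ≤ ∫ x, f x ∂μp := by
  haveI := ((mem_isingGibbsMeasures_iff d β h μ).1 hμ).isProbabilityMeasure
  exact holley_of_crossBox_spin μ μp (crossBox_gibbs_plusState hβ hμ μp hμp) hf hfm hfC

/-- **`∫ f dμ⁻ ≤ ∫ f dμ` for EVERY Gibbs measure and EVERY bounded measurable increasing functional.** [this work] -/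
theorem minusState_le_gibbs (hβ : 0 ≤ β) {μ : Measure (SpinConfig (Site d))} (hμ : μ ∈ isingGibbsMeasures d β h)
    (μm : Measure (SpinConfig (Site d))) [IsProbabilityMeasure μm]
    (hμm : ∀ B : Finset (Site d), spinCorr μm B = minusCorr d β h B) {f : SpinConfig (Site d) → ℝ}
    (hf : Monotone f) (hfm : Measurable f) {C : ℝ} (hfC : ∀ x, |f x| ≤ C) : ∫ x, f x ∂μm ≤ ∫ x, f x ∂μ := by
  haveI := ((mem_isingGibbsMeasures_iff d β h μ).1 hμ).isProbabilityMeasure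
  exact holley_of_crossBox_spin μm μ (crossBox_minusState_gibbs hβ hμ μm hμm) hf hfm hfC

/-- **THE DLR SANDWICH ON EVENTS**: `μ⁻(U) ≤ μ(U) ≤ μ⁺(U)` for every Gibbs measure `μ ∈ 𝒢(β,h)` and every measurable
increasing event `U` of `{−1,+1}^{ℤ^d}` (`β ≥ 0`, any `h`). [this work] -/
theorem gibbs_sandwich_upperSet (hβ : 0 ≤ β) {μ : Measure (SpinConfig (Site d))} (hμ : μ ∈ isingGibbsMeasures d β h)
    (μm μp : Measure (SpinConfig (Site d))) [IsProbabilityMeasure μm] [IsProbabilityMeasure μp]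
    (hμm : ∀ B : Finset (Site d), spinCorr μm B = minusCorr d β h B)
    (hμp : ∀ B : Finset (Site d), spinCorr μp B = plusCorr d β h B) {U : Set (SpinConfig (Site d))}
    (hU : IsUpperSet U) (hUm : MeasurableSet U) : μm U ≤ μ U ∧ μ U ≤ μp U :=
  ⟨minusState_le_gibbs_upperSet hβ hμ μm hμm hU hUm, gibbs_le_plusState_upperSet hβ hμ μp hμp hU hUm⟩

/-- **THE DLR SANDWICH ON FUNCTIONALS**: `∫ f dμ⁻ ≤ ∫ f dμ ≤ ∫ f dμ⁺` for every Gibbs measure `μ ∈ 𝒢(β,h)` and every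
bounded measurable increasing functional (Friedli–Velenik's (6.70) beyond local observables). [this work] -/
theorem gibbs_sandwich (hβ : 0 ≤ β) {μ : Measure (SpinConfig (Site d))} (hμ : μ ∈ isingGibbsMeasures d β h)
    (μm μp : Measure (SpinConfig (Site d))) [IsProbabilityMeasure μm] [IsProbabilityMeasure μp]
    (hμm : ∀ B : Finset (Site d), spinCorr μm B = minusCorr d β h B)
    (hμp : ∀ B : Finset (Site d), spinCorr μp B = plusCorr d β h B) {f : SpinConfig (Site d) → ℝ}
    (hf : Monotone f) (hfm : Measurable f) {C : ℝ} (hfC : ∀ x, |f x| ≤ C) :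
    ∫ x, f x ∂μm ≤ ∫ x, f x ∂μ ∧ ∫ x, f x ∂μ ≤ ∫ x, f x ∂μp :=
  ⟨minusState_le_gibbs hβ hμ μm hμm hf hfm hfC, gibbs_le_plusState hβ hμ μp hμp hf hfm hfC⟩

/-- **An increasing event on which `μ⁻` and `μ⁺` agree has the same probability under every Gibbs measure**
(e.g. every increasing tail event when `μ⁻ = μ⁺` on it). [this work] -/
theorem gibbs_upperSet_eq_of_minusState_eq_plusState (hβ : 0 ≤ β) {μ : Measure (SpinConfig (Site d))}
    (hμ : μ ∈ isingGibbsMeasures d β h) (μm μp : Measure (SpinConfig (Site d))) [IsProbabilityMeasure μm]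
    [IsProbabilityMeasure μp] (hμm : ∀ B : Finset (Site d), spinCorr μm B = minusCorr d β h B)
    (hμp : ∀ B : Finset (Site d), spinCorr μp B = plusCorr d β h B) {U : Set (SpinConfig (Site d))}
    (hU : IsUpperSet U) (hUm : MeasurableSet U) (heq : μm U = μp U) : μ U = μp U :=
  le_antisymm (gibbs_le_plusState_upperSet hβ hμ μp hμp hU hUm)
    (heq ▸ minusState_le_gibbs_upperSet hβ hμ μm hμm hU hUm)

/-- **The plus state is the maximum of `𝒢(β,h)` in the strong stochastic order** (`β ≥ 0`, any `h`): there is a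
translation-invariant Gibbs measure with the plus correlations which dominates EVERY Gibbs measure on every
measurable increasing event and every bounded measurable increasing functional. [this work] -/
theorem exists_gibbs_maximum (hβ : 0 ≤ β) :
    ∃ μp ∈ isingGibbsMeasures d β h, IsTranslationInvariantMeasure μp ∧
      (∀ B : Finset (Site d), spinCorr μp B = plusCorr d β h B) ∧
      (∀ μ ∈ isingGibbsMeasures d β h, ∀ U : Set (SpinConfig (Site d)), IsUpperSet U → MeasurableSet U →
        μ U ≤ μp U) ∧
      (∀ μ ∈ isingGibbsMeasures d β h, ∀ f : SpinConfig (Site d) → ℝ, Monotone f → Measurable f →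
        (∃ C, ∀ x, |f x| ≤ C) → ∫ x, f x ∂μ ≤ ∫ x, f x ∂μp) := by
  obtain ⟨μp, hμpG, hμpT, hμp⟩ := exists_plusMeasure_holds (d := d) (β := β) (h := h) hβ
  haveI := ((mem_isingGibbsMeasures_iff d β h μp).1 hμpG).isProbabilityMeasure
  exact ⟨μp, hμpG, hμpT, hμp, fun μ hμ U hU hUm => gibbs_le_plusState_upperSet hβ hμ μp hμp hU hUm,
    fun μ hμ f hf hfm ⟨C, hfC⟩ => gibbs_le_plusState hβ hμ μp hμp hf hfm hfC⟩

/-- **The minus state is the minimum of `𝒢(β,h)` in the strong stochastic order.** [this work] -/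
theorem exists_gibbs_minimum (hβ : 0 ≤ β) :
    ∃ μm ∈ isingGibbsMeasures d β h, IsTranslationInvariantMeasure μm ∧
      (∀ B : Finset (Site d), spinCorr μm B = minusCorr d β h B) ∧
      (∀ μ ∈ isingGibbsMeasures d β h, ∀ U : Set (SpinConfig (Site d)), IsUpperSet U → MeasurableSet U →
        μm U ≤ μ U) ∧
      (∀ μ ∈ isingGibbsMeasures d β h, ∀ f : SpinConfig (Site d) → ℝ, Monotone f → Measurable f →
        (∃ C, ∀ x, |f x| ≤ C) → ∫ x, f x ∂μm ≤ ∫ x, f x ∂μ) := by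
  obtain ⟨μm, hμmG, hμmT, hμm⟩ := exists_minusMeasure_holds (d := d) (β := β) (h := h) hβ
  haveI := ((mem_isingGibbsMeasures_iff d β h μm).1 hμmG).isProbabilityMeasure
  exact ⟨μm, hμmG, hμmT, hμm, fun μ hμ U hU hUm => minusState_le_gibbs_upperSet hβ hμ μm hμm hU hUm,
    fun μ hμ f hf hfm ⟨C, hfC⟩ => minusState_le_gibbs hβ hμ μm hμm hf hfm hfC⟩

end States

/-! ### Percolation of `+` spins under an arbitrary Gibbs measure -/

section PlusPercolation

open Literature.Probability.Percolation (sitePercolatesAt isUpperSet_sitePercolatesAt)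

variable {V : Type*}

/-- `ω ↦ S⁺(ω)` is monotone. [folklore] -/
theorem monotone_spinSites_one : Monotone (spinSites (V := V) 1) := fun _ _ hle => spinSites_one_mono hle

/-- **"`x` lies in an infinite `+` cluster" is an increasing event** of the spin configuration. [folklore] -/
theorem isUpperSet_preimage_spinSites_sitePercolatesAt (G : SimpleGraph V) (x : V) :
    IsUpperSet (spinSites (V := V) 1 ⁻¹' sitePercolatesAt G x) :=
  (isUpperSet_sitePercolatesAt G x).preimage monotone_spinSites_one

/-- **"there is an infinite `+` cluster" (`E⁺`) is an increasing event.** [folklore] -/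
theorem isUpperSet_existsInfCluster_one (G : SimpleGraph V) : IsUpperSet (existsInfCluster G (1 : ℤˣ)) := by
  intro ω ω' hle hω
  rw [mem_existsInfCluster_iff] at hω ⊢
  obtain ⟨x, hx⟩ := hω
  exact ⟨x, isUpperSet_sitePercolatesAt G x (monotone_spinSites_one hle) hx⟩

variable {d : ℕ} {β h : ℝ}

/-- **`+` PERCOLATION UNDER AN ARBITRARY GIBBS MEASURE IS SANDWICHED**: for every `μ ∈ 𝒢(β,h)` (`β ≥ 0`, any `h`) and
every site `x`, `μ⁻(x ↔ ∞ in S⁺) ≤ μ(x ↔ ∞ in S⁺) ≤ μ⁺(x ↔ ∞ in S⁺)` — a non-local increasing event, out of reach of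
the local sandwich `fkg_sandwich`. [this work] -/
theorem gibbs_sandwich_plusPercolatesAt (hβ : 0 ≤ β) {μ : Measure (SpinConfig (Site d))}
    (hμ : μ ∈ isingGibbsMeasures d β h) (μm μp : Measure (SpinConfig (Site d))) [IsProbabilityMeasure μm]
    [IsProbabilityMeasure μp] (hμm : ∀ B : Finset (Site d), spinCorr μm B = minusCorr d β h B)
    (hμp : ∀ B : Finset (Site d), spinCorr μp B = plusCorr d β h B) (x : Site d) :
    μm (spinSites 1 ⁻¹' sitePercolatesAt (zdGraph d) x) ≤ μ (spinSites 1 ⁻¹' sitePercolatesAt (zdGraph d) x) ∧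
      μ (spinSites 1 ⁻¹' sitePercolatesAt (zdGraph d) x) ≤ μp (spinSites 1 ⁻¹' sitePercolatesAt (zdGraph d) x) := by
  classical
  exact gibbs_sandwich_upperSet hβ hμ μm μp hμm hμp (isUpperSet_preimage_spinSites_sitePercolatesAt _ x)
    ((measurable_spinSites 1) (measurableSet_sitePercolatesAt x))

/-- **The event `E⁺` "an infinite `+` cluster exists" under an arbitrary Gibbs measure**:
`μ⁻(E⁺) ≤ μ(E⁺) ≤ μ⁺(E⁺)` for every `μ ∈ 𝒢(β,h)` (an increasing TAIL event). [this work] -/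
theorem gibbs_sandwich_existsInfCluster (hβ : 0 ≤ β) {μ : Measure (SpinConfig (Site d))}
    (hμ : μ ∈ isingGibbsMeasures d β h) (μm μp : Measure (SpinConfig (Site d))) [IsProbabilityMeasure μm]
    [IsProbabilityMeasure μp] (hμm : ∀ B : Finset (Site d), spinCorr μm B = minusCorr d β h B)
    (hμp : ∀ B : Finset (Site d), spinCorr μp B = plusCorr d β h B) :
    μm (existsInfCluster (zdGraph d) 1) ≤ μ (existsInfCluster (zdGraph d) 1) ∧
      μ (existsInfCluster (zdGraph d) 1) ≤ μp (existsInfCluster (zdGraph d) 1) := by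
  classical
  exact gibbs_sandwich_upperSet hβ hμ μm μp hμm hμp (isUpperSet_existsInfCluster_one _)
    (measurableSet_existsInfCluster 1)

/-- In particular **if the plus state has no infinite `+` cluster, no Gibbs measure has one**, and if the minus state
has one almost surely, every Gibbs measure has one almost surely. [this work] -/
theorem gibbs_existsInfCluster_eq_zero_of_plusState (hβ : 0 ≤ β) {μ : Measure (SpinConfig (Site d))}
    (hμ : μ ∈ isingGibbsMeasures d β h) (μp : Measure (SpinConfig (Site d))) [IsProbabilityMeasure μp]
    (hμp : ∀ B : Finset (Site d), spinCorr μp B = plusCorr d β h B) (h0 : μp (existsInfCluster (zdGraph d) 1) = 0) :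
    μ (existsInfCluster (zdGraph d) 1) = 0 := by
  classical
  exact le_antisymm (h0 ▸ gibbs_le_plusState_upperSet hβ hμ μp hμp (isUpperSet_existsInfCluster_one _)
    (measurableSet_existsInfCluster 1)) bot_le

/-- … and if the minus state has an infinite `+` cluster almost surely, so does every Gibbs measure. [this work] -/
theorem gibbs_existsInfCluster_eq_one_of_minusState (hβ : 0 ≤ β) {μ : Measure (SpinConfig (Site d))}
    (hμ : μ ∈ isingGibbsMeasures d β h) (μm : Measure (SpinConfig (Site d))) [IsProbabilityMeasure μm]
    (hμm : ∀ B : Finset (Site d), spinCorr μm B = minusCorr d β h B) (h1 : μm (existsInfCluster (zdGraph d) 1) = 1) :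
    μ (existsInfCluster (zdGraph d) 1) = 1 := by
  classical
  haveI := ((mem_isingGibbsMeasures_iff d β h μ).1 hμ).isProbabilityMeasure
  exact le_antisymm prob_le_one (h1 ▸ minusState_le_gibbs_upperSet hβ hμ μm hμm
    (isUpperSet_existsInfCluster_one _) (measurableSet_existsInfCluster 1))

end PlusPercolation

end Summit.CriticalPhenomena.PercolationContinuityZ3.Theorems.SahiBoxTP2
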